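/-
Copyright (c) 2026. Released under the Apache 2.0 license.
-/
import Mathlib.FieldTheory.IntermediateField.Adjoin.Basic
import Literature.NumberTheory.EllipticCurves.NewformCuspFourierValuation
import HarnessLib

/-!
# The coefficient field of the Fourier expansion of a modular form on `Γ₀(N)` at a cusp
# (Brunault–Neururer, Ramanujan J. 53 (2020), Thm. 4.1 and Thm. 7.6)

The source. F. Brunault, M. Neururer, *Fourier expansions at cusps*, Ramanujan J. 53 (2020),
no. 2, 423–437 (bib key `BrunaultNeururer2019`; held: `paper:arxiv-1807.00391`, LaTeXML chunks —
Thm. 4.1 = chunk p0007, Thm. 7.6 = chunk p0011; the numbering is that of the arXiv text, which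
the citing paper below uses for Thm. 7.6). Cited by Česnavičius–Neururer–Saha, *The Manin constant
and the modular degree*, JEMS 26 (2024), §4.3 (p. 29): "For such an `f` [a normalized newform on
`Γ₀(N)`], the Fourier coefficients `a_f(n;γ)` at any cusp `𝔠 = γ∞` of denominator `L` lie in
`K_f(ζ_{N/L})` (see [BN19, Theorem 7.6], which even exhibits the possibly smaller number field
generated by the `a_f(n;γ)`)" — the arithmetic companion of the `p`-adic bounds of ČNS Thm. 4.6 /
Cor. 4.7 (`NewformCuspFourierValuation*.lean`), in the same vocabulary
(`fourierCoeffAtCusp N k f γ n = a_f(n;γ)`, the `n`-th coefficient of `f|_k γ` in the parameter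
`e^{2πiτ/w(𝔠)}`, `cuspDenominator N γ = L = gcd(c, N)`).

## The printed statements, verbatim

Notation (§ Notations, chunk p0003): "`f|_k g(τ) = det(g)^{k/2} (cτ+d)^{-k} f((aτ+b)/(cτ+d))`"
(Mathlib's slash action for `g ∈ SL₂(ℤ)`); "for any modular form `f(τ) = ∑_n a_n e^{2πinτ/w}`, we
let `f^σ(τ) = ∑_n σ(a_n) e^{2πinτ/w}`"; "`ζ_N = e^{2πi/N} ∈ ℂ`". The "coefficients of `f|g`" are the
`a_n` of such an expansion of `f|g` in ANY period `w`; for `f` on `Γ₀(N)` the width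
`w(g∞) = N/gcd(N, c²)` is one (`Fuchsian.conj_T_zpow_mem_Gamma0_iff`), and changing the period
among multiples re-indexes the same set of coefficients, so "the field generated by the Fourier
coefficients of `f|_k g`" is `ℚ({a_f(n;g)}_n)` in the tree's indexing.

**Theorem 4.1** (chunk p0007). "Let `f ∈ M_k(Γ₁(N))` be a modular form of integral weight
`k ≥ 1` on `Γ₁(N)`. Let `K_f` be the subfield of `ℂ` generated by the Fourier coefficients `a_n(f)`,
`n ≥ 1`. Let `g = (A B; C D) ∈ SL₂(ℤ)`. • The modular form `f|_k g` has coefficients in `K_f(ζ_M)`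
with `M = N/gcd(C, N)`. • If `f ∈ M_k(Γ₀(N))` then `f|_k g` has coefficients in `K_f(ζ_{N′})` with
`N′ = N/gcd(CD, N)`."

**Theorem 7.6** (chunk p0011; §7: "we assume that `f` is a newform of (even) weight `k ≥ 2` on
the group `Γ₀(N)`"). "Let `f` be a newform of weight `k ≥ 2` on `Γ₀(N)`. Let
`g = (A B; C D) ∈ SL₂(ℤ)`. Then the field generated by the Fourier coefficients of `f|_k g` is
equal to `K_f(ζ_{N′})` with `N′ = N/gcd(CD, N)`."

## Rendering
* `K_f = ℚ(a_n(f) : n ≥ 1)` ↦ `IntermediateField.adjoin ℚ (Set.range fun m ↦ a_{m+1}(f))` inside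
  `ℂ`, `a_n(f)` the coefficients of the `q`-expansion at `∞` (`qExpansion 1 f`); `K_f(ζ)` ↦ adjoin
  the union with `{ζ}`; `ζ_m = Complex.exp (2πi/m)` (`BrunaultNeururer2019.zeta`).
* Thm. 4.1 is transcribed for `f ∈ M_k(Γ₀(N))` (the tree's `fourierCoeffAtCusp N k` uses the
  `Γ₀(N)`-width): the second bullet verbatim (`brunaultNeururer2019_thm_4_1`), and the first bullet
  at `f ∈ M_k(Γ₀(N)) ⊂ M_k(Γ₁(N))` — the form ČNS quotes, `M = N/gcd(C, N) = N/L` — PROVED from it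
  (`N′ ∣ M`, so `ζ_{N′} = ζ_M^{M/N′} ∈ K_f(ζ_M)`): `fourierCoeffAtCusp_mem_adjoin_zeta_level_div`.
  `TODO(general form)`: the first bullet for `f ∈ M_k(Γ₁(N))` proper (needs the `Γ₁(N)`-width).
* Thm. 7.6 verbatim for `f ∈ newforms0 N k`, `2 ≤ k` (`brunaultNeururer2019_thm_7_6`).
Both are named facts (statements only).

## References
* [BrunaultNeururer2019] op. cit., § Notations, Thm. 4.1, Thm. 7.6 (arXiv:1807.00391).
* [CesnaviciusNeururerSaha2023] K. Česnavičius, M. Neururer, A. Saha, *The Manin constant and the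
  modular degree*, JEMS 26 (2024), §4.3 (p. 29).
-/

noncomputable section

open scoped MatrixGroups ModularForm Real

open CongruenceSubgroup UpperHalfPlane Complex

namespace Literature.NumberTheory.EllipticCurves.ModularForms

namespace BrunaultNeururer2019

/-- `ζ_m = e^{2πi/m} ∈ ℂ` (BN § Notations: "`ζ_N = e^{2πi/N} ∈ ℂ`").
[cite: BrunaultNeururer2019, § Notations] -/
def zeta (m : ℕ) : ℂ := Complex.exp (2 * π * Complex.I / m)

/-- `ζ_{m} = ζ_{m d} ^ d`: a root of unity of order dividing `md` is a power of `ζ_{md}`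
(`m, d ≥ 1`). [cite: BrunaultNeururer2019, § Notations] -/
theorem zeta_mul_pow (m d : ℕ) (hm : m ≠ 0) (hd : d ≠ 0) : zeta (m * d) ^ d = zeta m := by
  rw [zeta, zeta, ← Complex.exp_nat_mul]
  congr 1
  have hm' : (m : ℂ) ≠ 0 := Nat.cast_ne_zero.mpr hm
  have hd' : (d : ℂ) ≠ 0 := Nat.cast_ne_zero.mpr hd
  push_cast
  field_simp

/-- **The coefficient field `K_f = ℚ(a_n(f) : n ≥ 1)` of a function on `ℍ` with a `q`-expansion at
`∞`** (BN Thm. 4.1: "the subfield of `ℂ` generated by the Fourier coefficients `a_n(f)`, `n ≥ 1`"),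
as an intermediate field of `ℂ/ℚ`; `a_n(f)` = the coefficients of `qExpansion 1 f`.
[cite: BrunaultNeururer2019, Thm. 4.1] -/
def coeffFieldInfty (f : ℍ → ℂ) : IntermediateField ℚ ℂ :=
  IntermediateField.adjoin ℚ (Set.range fun m : ℕ ↦ (qExpansion 1 f).coeff (m + 1))

/-- `K_f = ℚ(a_n(f) : n ≥ 1)` is contained in the tree's coefficient field
`coeffField f = ℚ(a_n(f) : n ≥ 0)` of a cusp form (`Newforms.lean`; they agree, `a_0(f) = 0`).
[cite: BrunaultNeururer2019, Thm. 4.1] -/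
theorem coeffFieldInfty_le_coeffField {Γ : Subgroup (GL (Fin 2) ℝ)} {k : ℤ} (f : CuspForm Γ k) :
    coeffFieldInfty ⇑f ≤ coeffField f :=
  IntermediateField.adjoin.mono ℚ _ _ (by rintro _ ⟨m, rfl⟩; exact ⟨m + 1, rfl⟩)

/-- **`K_f(ζ_m)`**. [cite: BrunaultNeururer2019, Thm. 4.1] -/
def coeffFieldInftyAdjoinZeta (f : ℍ → ℂ) (m : ℕ) : IntermediateField ℚ ℂ :=
  IntermediateField.adjoin ℚ ((Set.range fun m : ℕ ↦ (qExpansion 1 f).coeff (m + 1)) ∪ {zeta m})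

/-- `K_f(ζ_m) ≤ K_f(ζ_{md})` (`ζ_m = ζ_{md}^d`). [cite: BrunaultNeururer2019, Thm. 4.1] -/
theorem coeffFieldInftyAdjoinZeta_le_of_dvd (f : ℍ → ℂ) {m m' : ℕ} (hm : m ≠ 0) (hm' : m' ≠ 0)
    (h : m ∣ m') : coeffFieldInftyAdjoinZeta f m ≤ coeffFieldInftyAdjoinZeta f m' := by
  obtain ⟨d, rfl⟩ := h
  have hd : d ≠ 0 := fun hd ↦ hm' (by rw [hd, mul_zero])
  unfold coeffFieldInftyAdjoinZeta
  rw [IntermediateField.adjoin_le_iff]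
  rintro x (⟨n, rfl⟩ | hx)
  · exact IntermediateField.subset_adjoin ℚ _ (Or.inl ⟨n, rfl⟩)
  · have hz : zeta (m * d) ∈ IntermediateField.adjoin ℚ
        ((Set.range fun m : ℕ ↦ (qExpansion 1 f).coeff (m + 1)) ∪ {zeta (m * d)}) :=
      IntermediateField.subset_adjoin ℚ _ (Or.inr rfl)
    rw [Set.mem_singleton_iff.mp hx, ← zeta_mul_pow m d hm hd]
    exact pow_mem hz d

/-- **The field generated by the Fourier coefficients of `f|_k g`** at the cusp `g∞` of `Γ₀(N)`:
`ℚ(a_f(n; g) : n ≥ 0)` (BN Thm. 7.6: "the field generated by the Fourier coefficients of `f|_k g`"),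
in the tree's indexing by the `Γ₀(N)`-width (module docstring: the field does not depend on the
period used). [cite: BrunaultNeururer2019, Thm. 7.6] -/
def cuspCoeffField (N : ℕ) (k : ℤ) (f : ℍ → ℂ) (g : SL(2, ℤ)) : IntermediateField ℚ ℂ :=
  IntermediateField.adjoin ℚ (Set.range fun n : ℕ ↦ fourierCoeffAtCusp N k f g n)

/-- The printed level `N′ = N/gcd(CD, N)` of BN Thm. 4.1 (2) / Thm. 7.6 for `g = (A B; C D)`.
[cite: BrunaultNeururer2019, Thm. 4.1] -/
def levelPrime (N : ℕ) (g : SL(2, ℤ)) : ℕ :=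
  N / Nat.gcd ((g : Matrix (Fin 2) (Fin 2) ℤ) 1 0 * (g : Matrix (Fin 2) (Fin 2) ℤ) 1 1).natAbs N

/-- `N′ = N/gcd(CD, N)` divides `M = N/gcd(C, N) = N/L` (`gcd(C, N) ∣ gcd(CD, N)`).
[cite: BrunaultNeururer2019, Thm. 4.1] -/
theorem levelPrime_dvd_level_div_cuspDenominator (N : ℕ) (g : SL(2, ℤ)) :
    levelPrime N g ∣ N / cuspDenominator N g := by
  unfold levelPrime cuspDenominator
  set C := (g : Matrix (Fin 2) (Fin 2) ℤ) 1 0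
  set D := (g : Matrix (Fin 2) (Fin 2) ℤ) 1 1
  have h1 : Nat.gcd C.natAbs N ∣ Nat.gcd (C * D).natAbs N :=
    Nat.dvd_gcd ((Nat.gcd_dvd_left _ _).trans (by rw [Int.natAbs_mul]; exact dvd_mul_right _ _))
      (Nat.gcd_dvd_right _ _)
  obtain ⟨e, he⟩ := h1
  rcases eq_or_ne (Nat.gcd C.natAbs N) 0 with h0 | h0
  · simp [h0, he]
  refine ⟨e, ?_⟩
  rw [he, ← Nat.div_div_eq_div_mul, Nat.div_mul_cancel]
  -- `e ∣ N / gcd(C, N)` since `gcd(C,N) · e = gcd(CD, N) ∣ N`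
  exact Nat.dvd_div_of_mul_dvd (he ▸ Nat.gcd_dvd_right _ _)

end BrunaultNeururer2019

open BrunaultNeururer2019

/-! ### Thm. 4.1 (2): `a_f(n; g) ∈ K_f(ζ_{N′})` for `f ∈ M_k(Γ₀(N))` — named fact -/

/-- **Brunault–Neururer 2020, Thm. 4.1 (second bullet).** Printed (Ramanujan J. 53 (2020), Thm. 4.1;
arXiv:1807.00391 chunk p0007), verbatim: "Let `f ∈ M_k(Γ₁(N))` be a modular form of integral weight
`k ≥ 1` on `Γ₁(N)`. Let `K_f` be the subfield of `ℂ` generated by the Fourier coefficients `a_n(f)`,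
`n ≥ 1`. Let `g = (A B; C D) ∈ SL₂(ℤ)`. … • If `f ∈ M_k(Γ₀(N))` then `f|_k g` has coefficients in
`K_f(ζ_{N′})` with `N′ = N/gcd(CD, N)`." Rendering (module docstring): for every `N ≥ 1`, `k ≥ 1`,
`f ∈ M_k(Γ₀(N))`, `g ∈ SL(2, ℤ)` and `n`, the coefficient `a_f(n; g)` of the expansion of `f|_k g` in
`e^{2πiτ/w(g∞)}` lies in `K_f(ζ_{N′})`. FAITHFUL (at `f` on `Γ₀(N)`). Named fact (statement only).
[cite: BrunaultNeururer2019, Thm. 4.1 (2)] -/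
def brunaultNeururer2019_thm_4_1 : Prop :=
  ∀ (N : ℕ) [NeZero N] (k : ℤ), 1 ≤ k → ∀ (f : ModularForm (Gamma0 N) k) (g : SL(2, ℤ)) (n : ℕ),
    fourierCoeffAtCusp N k ⇑f g n ∈ coeffFieldInftyAdjoinZeta ⇑f (levelPrime N g)

-- TODO(general form): Thm. 4.1 (1) for `f ∈ M_k(Γ₁(N))` proper (`K_f(ζ_M)`, `M = N/gcd(C, N)`, with
-- the `Γ₁(N)`-width); for `f` on `Γ₀(N)` it is the corollary below.

/-- **Thm. 4.1 (1) at `f ∈ M_k(Γ₀(N))` = the sentence of ČNS §4.3**: `a_f(n; g) ∈ K_f(ζ_{N/L})`,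
`L = gcd(C, N)` the denominator of the cusp `g∞` — from the fact, since `N′ ∣ N/L`
(`levelPrime_dvd_level_div_cuspDenominator`) and `ζ_{N′}` is a power of `ζ_{N/L}`.
[cite: BrunaultNeururer2019, Thm. 4.1 (1)] [cite: CesnaviciusNeururerSaha2023, §4.3 (p. 29)] -/
theorem fourierCoeffAtCusp_mem_adjoin_zeta_level_div (h : brunaultNeururer2019_thm_4_1) {N : ℕ}
    [NeZero N] {k : ℤ} (hk : 1 ≤ k) (f : ModularForm (Gamma0 N) k) (g : SL(2, ℤ)) (n : ℕ) :
    fourierCoeffAtCusp N k ⇑f g n ∈ coeffFieldInftyAdjoinZeta ⇑f (N / cuspDenominator N g) := by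
  have hN : N ≠ 0 := NeZero.ne N
  have hL : cuspDenominator N g ∣ N := cuspDenominator_dvd N g
  have hL0 : cuspDenominator N g ≠ 0 := fun h0 ↦ hN (Nat.eq_zero_of_zero_dvd (h0 ▸ hL))
  have hM : N / cuspDenominator N g ≠ 0 := (Nat.div_ne_zero_iff_of_dvd hL).mpr ⟨hN, hL0⟩
  have hN' : levelPrime N g ≠ 0 := fun h0 ↦
    hM (Nat.eq_zero_of_zero_dvd (h0 ▸ levelPrime_dvd_level_div_cuspDenominator N g))
  exact coeffFieldInftyAdjoinZeta_le_of_dvd ⇑f hN' hM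
    (levelPrime_dvd_level_div_cuspDenominator N g) (h N k hk f g n)

/-! ### Thm. 7.6: for a newform the field generated IS `K_f(ζ_{N′})` — named fact -/

/-- **Brunault–Neururer 2020, Thm. 7.6 (the exact coefficient field at a cusp of a `Γ₀(N)`-newform).**
Printed (Ramanujan J. 53 (2020), Thm. 7.6; arXiv:1807.00391 chunk p0011), verbatim: "Let `f` be a
newform of weight `k ≥ 2` on `Γ₀(N)`. Let `g = (A B; C D) ∈ SL₂(ℤ)`. Then the field generated by
the Fourier coefficients of `f|_k g` is equal to `K_f(ζ_{N′})` with `N′ = N/gcd(CD, N)`." Rendering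
(module docstring): for `f ∈ newforms0 N k` (normalised new Hecke eigenform on `Γ₀(N)`), `2 ≤ k`,
and `g ∈ SL(2, ℤ)`: `ℚ(a_f(n; g) : n) = ℚ(a_n(f) : n ≥ 1)(ζ_{N′})` as subfields of `ℂ`. FAITHFUL.
Named fact (statement only); "which even exhibits the possibly smaller number field generated by
the `a_f(n;γ)`" (ČNS §4.3). [cite: BrunaultNeururer2019, Thm. 7.6] -/
def brunaultNeururer2019_thm_7_6 : Prop :=
  ∀ (N : ℕ) [NeZero N] (k : ℤ), 2 ≤ k → ∀ (f : CuspForm (Gamma0 N) k), f ∈ newforms0 N k →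
    ∀ g : SL(2, ℤ), cuspCoeffField N k ⇑f g = coeffFieldInftyAdjoinZeta ⇑f (levelPrime N g)

/-- Under Thm. 7.6, each `a_f(n; g)` of a newform lies in `K_f(ζ_{N′})` (the containment half, as in
Thm. 4.1 (2)). [cite: BrunaultNeururer2019, Thm. 7.6] -/
theorem fourierCoeffAtCusp_mem_of_thm_7_6 (h : brunaultNeururer2019_thm_7_6) {N : ℕ} [NeZero N]
    {k : ℤ} (hk : 2 ≤ k) {f : CuspForm (Gamma0 N) k} (hf : f ∈ newforms0 N k) (g : SL(2, ℤ))
    (n : ℕ) : fourierCoeffAtCusp N k ⇑f g n ∈ coeffFieldInftyAdjoinZeta ⇑f (levelPrime N g) := by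
  rw [← h N k hk f hf g]
  exact IntermediateField.subset_adjoin _ _ ⟨n, rfl⟩

/-- Under Thm. 7.6, conversely `ζ_{N′}` lies in the field generated by the `a_f(n; g)` (the
"exactness" half: the cyclotomic part is really there).
[cite: BrunaultNeururer2019, Thm. 7.6] -/
theorem zeta_levelPrime_mem_cuspCoeffField_of_thm_7_6 (h : brunaultNeururer2019_thm_7_6) {N : ℕ}
    [NeZero N] {k : ℤ} (hk : 2 ≤ k) {f : CuspForm (Gamma0 N) k} (hf : f ∈ newforms0 N k)
    (g : SL(2, ℤ)) : zeta (levelPrime N g) ∈ cuspCoeffField N k ⇑f g := by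
  rw [h N k hk f hf g]
  exact IntermediateField.subset_adjoin _ _ (Or.inr rfl)

end Literature.NumberTheory.EllipticCurves.ModularForms

end
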